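import Summits.BirchSwinnertonDyer.BirchSwinnertonDyer.Theorems.ClassRecordThreeCornerAtThreeWOfInputs
import Summits.BirchSwinnertonDyer.BirchSwinnertonDyer.Theorems.ClassRecordThreeCornerAtThreeShimuraPrimitivesDivOfE0PrimeTD
import Summits.BirchSwinnertonDyer.BirchSwinnertonDyer.Theorems.ClassRecordThreeCornerAtThreeShimuraSplitAuxNormOfStubs
import Summits.BirchSwinnertonDyer.BirchSwinnertonDyer.Theorems.ClassRecordThreeCornerAtThreeShimuraSplitAuxNormOfStubsR18

/-!
# Crux 21420 `CornerAtThreeW`: the ITEMS-CLOSERS for the r16 (E′TD) and r17 (split auxiliary-norm) shapes of `Lines/inert.lean` —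
# (U) class-wide and both route decls BY NAME with the (B6)-slot re-keyed (cell `bsd-stepL`, seat `bsd-stepL-corner3-p2` g14 = lane B;
# `--supports stmt-BirchSwinnertonDyer-21420 --as helper`)

WHY (plan g41 RULING 68 (d): phase 2 at `3` is re-targeted on Gross's E′-label ∕ the print-level leaves; r16 is QUEUED for the registry, r17 is a sha-pinned
turnkey). `…CornerAtThreeWOfInputs` (p640636) closes the crux modulo the SEVEN r15 stub texts ∕ the CR3 items + raw inputs, with the (B6)-slot `hB6 :
ShimuraWalk.PrimitivesWithB6TDAtThree`. THIS FILE gives the same closers with that slot replaced by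
* (r16) `hE0 : ShimuraWalk.PrimitivesWithE0PrimeTDAtThree` (Gross's E′-label at the carriers; (DIV) from it alone, p642540), and
* (r17) `hres : ShimuraWalk.PrimitivesWithSplitNormTDAtThree ∧ ‹tam3-p1 g18's stub_carrierLocalE0AtThree text› ∧ ‹AuxiliarySplitLevel on the corner frames›`
  (the corner's saved display D from it, p644690, then lane B g12's anchor consumer `…_of_displays_of_residualAnchor_of_twinLowerD`) — NO label at all.
Theorems: `cornerAtThreeUpper_of_inputsE0Prime` ∕ `cornerAtThreeUpper_of_inputsR17` ((U) = birth's `Theorems.CornerAtThreeUpper` class-wide), and the items-closers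
`cornerAtThreeW_of_itemsE0Prime` ∕ `cornerAtThreeW_of_itemsR17` (+ `KolyvaginRoadThree` twins): CR3 items 19112 ∕ 19524 ∕ 20191 BY NAME + raw rest — their audit
`proof.conditional` lists ARE the phase-2 itemization lists for the two shapes.
HONEST FRAMING: THEOREMS ONLY (no definition, no named fact, no `sorry`); CONDITIONAL on the displayed hypotheses; imports the route cone by design; (L) STEP L is
OPEN mathematics and enters only as a hypothesis; item 21420 is NOT closed by this file; no census label moves (T7); BSD is proved for no curve.
References: as `Lines/inert.lean` r16 ∕ r17 (lane B g14 cards `inertW_r16.md` ∕ `inertW_r17.md`). presearch: n∕a (re-packaging). Axioms: the trio.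
-/

set_option linter.dupNamespace false
set_option autoImplicit false

noncomputable section

namespace Summit.BirchSwinnertonDyer.BirchSwinnertonDyer.Theorems.CornerAtThreeWOfInputs

open scoped Classical NumberField Pointwise
open CongruenceSubgroup WeierstrassCurve NumberField IsDedekindDomain Literature.NumberTheory.EllipticCurves
  Literature.NumberTheory.EllipticCurves.ModularForms Literature.NumberTheory.GaloisCohomology
  Literature.NumberTheory.EllipticCurves.Rank1Residual Literature.NumberTheory.EllipticCurves.Rank1Residual.Typed
  Literature.NumberTheory.EllipticCurves.BarriosEtAl2025 Literature.NumberTheory.Automorphic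
  Summit.BirchSwinnertonDyer.Rank1Residual
  Summit.BirchSwinnertonDyer.Rank1Residual.X11b Summit.BirchSwinnertonDyer.Rank1Residual.X11b.Three
  Summit.BirchSwinnertonDyer.BirchSwinnertonDyer.Theorems

/-! ## §1 (U) class-wide from the corner's SAVED display D (the common tail of r16 and r17) -/

/-- **Birth's `Theorems.CornerAtThreeUpper` from stub texts (2)(3)(5)(6)(7) and the corner's SAVED display `hIs : CornerAtThreeShimuraInertSavedDisplayD`** —
the common tail of the r16 and r17 consumers: the residual binder (mono branch = X₀(N) MAX walk END; multi branch EMPTY), lane B g12's anchor consumer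
`cornerAtThreeUpperConsumed_of_displays_of_residualAnchor_of_twinLowerD` on `hIs`, the converse bridge (A). CONDITIONAL; nothing booked.
[cite: GrossLMS1991, Prop. 3.7 (2), §6] [cite: Jetchev2008, Thm. 1.1, Cor. 1.5] [cite: MilneADT2006, Ch. I, Thm. 4.10, §6] -/
theorem cornerAtThreeUpper_of_inputs_of_savedDisplayD
    (hMono :
      Literature.NumberTheory.EllipticCurves.GrossLMS1991.prop37_2_frobeniusCongruence ∧
      Literature.NumberTheory.EllipticCurves.Gross1991_heegnerPoint_sub_ratTorsion_mem_E0_imageFree)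
    (hInert :
      (∀ (K : Type) [Field K] [NumberField K], Literature.NumberTheory.EllipticCurves.casselsTate_levelInputs K) ∧
      Literature.NumberTheory.EllipticCurves.shimuraCurve_heegnerSystem_primitivesAtThreeInert ∧
      Literature.NumberTheory.EllipticCurves.shimuraCurve_heegnerSystem_primitivesAtThreeGuarded ∧
      Summit.BirchSwinnertonDyer.BirchSwinnertonDyer.Theorems.CornerAtThreeFHTwinLowerSupply)
    (hIs : CornerAtThreeShimuraInertSavedDisplayD)
    (hL : Summit.BirchSwinnertonDyer.BirchSwinnertonDyer.Theorems.CornerAtThreeTwistLower)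
    (hμ : Summit.BirchSwinnertonDyer.BirchSwinnertonDyer.Theorems.CornerAtThreeTwistMuAn)
    (hFacts :
      (Literature.NumberTheory.EllipticCurves.SteinWuthrich2013.thm61_splitMultiplicative ∧
        Literature.NumberTheory.EllipticCurves.SteinWuthrich2013.thm61_nonsplitMultiplicative ∧
        Literature.NumberTheory.EllipticCurves.rank_eq_analyticRank_of_analyticRank_le_one ∧
        WeierstrassCurve.hasEntireLFunction_rat ∧
        Literature.NumberTheory.EllipticCurves.ModularForms.nonempty_modularParametrizationData ∧
        (∀ (W : WeierstrassCurve ℚ) [W.IsElliptic] [W.IsGloballyMinimal] (p : ℕ) [Fact p.Prime],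
          Literature.NumberTheory.EllipticCurves.greenberg_stevens W p) ∧
        Literature.NumberTheory.EllipticCurves.Kato2004.thm12_4 ∧
        Literature.NumberTheory.EllipticCurves.Kato2004.exists_multDivisibilityInputs_nonsplit ∧
        Literature.NumberTheory.EllipticCurves.Kato2004.exists_multDivisibilityInputs_split ∧
        Literature.NumberTheory.EllipticCurves.Greenberg1999.thm15_isTorsion_multiplicative_rat ∧
        Literature.NumberTheory.EllipticCurves.Wuthrich2014.corollary18_padicLFunction_mem_iwasawaAlgebra_multiplicative ∧
        Literature.NumberTheory.EllipticCurves.Kato2004.exists_multDivisibilityInputs_fine) ∧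
      (∀ (N : ℕ) [NeZero N] (W : WeierstrassCurve ℚ) (K : Type) [Field K] [NumberField K], kolyvagin N W K) ∧
      exists_isNewformOf ∧
      (∀ (N : ℕ) [NeZero N] (W : WeierstrassCurve ℚ) (K : Type) [Field K] [NumberField K], gross_zagier N W K) ∧
      HoffsteinLuo1997_exists_twist_L_one_ne_zero ∧
      mazur_not_dvd_maninConstant_of_odd ∧
      friedbergHoffstein_exists_twist_ne_zero_inertAt ∧
      nonempty_shimuraParametrizationData ∧
      PastenShimura2024_componentOrders ∧
      shimuraCurve_heegnerPoint_grossZagier) :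
    Summit.BirchSwinnertonDyer.BirchSwinnertonDyer.Theorems.CornerAtThreeUpper := by
  haveI : Fact (Nat.Prime 3) := ⟨Nat.prime_three⟩
  obtain ⟨hKato, hKo, hnf, hGZ, hHL, hMaz, -, hJL, hCO, hGZc⟩ := hFacts
  have hGZK := hKato.2.2.1
  have hmod := hKato.2.2.2.1
  obtain ⟨h37, hF1⟩ := hMono
  obtain ⟨hCT, hES, hES', hTL3⟩ := hInert
  have hTw : ∀ (W : WeierstrassCurve ℚ) [W.IsElliptic] [W.IsGloballyMinimal], CornerTwistAt W :=
    cornerTwistAt_of_inputs hL hμ hKato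
  have hrec : ∀ (N : ℕ) [NeZero N] (W : WeierstrassCurve ℚ) (K : Type) [Field K] [NumberField K],
      heegnerPointOfConductor_one_galoisConj N W K :=
    fun N _ W K _ _ ↦ heegnerPointOfConductor_one_galoisConj_holds N W K
  have hD36 : ∀ (N : ℕ) [NeZero N] (W : WeierstrassCurve ℚ) (K : Type) [Field K] [NumberField K],
      phi_heegnerTau_mem_singularModuliField N W K :=
    fun N _ W K _ _ ↦ phi_heegnerTau_mem_singularModuliField_holds N W K
  have hPTc : ∀ (K : Type) [Field K] [NumberField K], poitouTate_selmerStructure_duality_conj K :=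
    Koly.poitouTate_conj_forall_of_selmerComplement_canonical fun K _ _ n _ ↦
      SchneiderFreeAdditiveX3.PoitouTateReduction.selmerComplement_canonical_holds K n
  have hres : ∀ (W : WeierstrassCurve ℚ) [W.IsElliptic] [W.IsGloballyMinimal],
      ClassX11b W 3 → ¬ Surj W 3 → 3 ∣ W.tamagawaProduct → ¬ Three.CornerInertAdmissibleAnchor W →
      ¬ Three.CornerInertAdmissibleUpToOneAnchor W → Typed.MissingUpperBoundAt W 3 := by
    intro W _ _ hX hns _ hnadm hnadm1
    by_cases hmono : ∃ v : HeightOneSpectrum (𝓞 ℚ),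
        padicValNat 3 W.tamagawaProduct ≤ padicValNat 3 (W.tamagawaNumberAt v)
    · have hF8 : CornerTwinHalves.CornerTwinLowerModEightAt W := by
        by_cases h2N : 2 ∣ W.conductorNorm ℤ
        · exact CornerTwinHalves.cornerTwinLowerModEightAt_of_fhTwinLowerSupplyAt_of_two_dvd W h2N (hTL3 W hX hns)
        · exact CornerTwinHalves.cornerTwinLowerModEightAt_of_cornerTwistAt hnf hHL hGZK hmod W (hTw W)
      exact Three.missingUpperBoundAt_monoCarrier_of_threeNamedFacts_of_twinLowerModEight_of_casselsTate h37 hPTc hF1 hCT hGZ hKo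
        hGZK hmod hnf hMaz hrec hD36 W hX hns hmono hF8
    · push Not at hmono
      exact Three.missingUpperBoundAt_of_multiCarrier_of_not_anchor W hX hns hmono hnadm hnadm1
  have hCons : Summit.BirchSwinnertonDyer.BirchSwinnertonDyer.Theorems.CornerAtThreeUpperConsumed := by
    obtain ⟨hI, h7⟩ := ShimuraKolyvaginOfImage.stub_upper3_inertDisplay_conj12_of_named hCT hES hES'
    have hBR : localTamagawaNumber_quadraticTwist_two_mem_of_goodReduction :=
      BarriosEtAl2025.localTamagawaNumber_quadraticTwist_two_mem_of_goodReduction_holds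
    exact cornerAtThreeUpperConsumed_of_displays_of_residualAnchor_of_twinLowerD hGZK hmod hnf hMaz hBR hJL hCO hGZc h7 hI hIs
      (fun W _ _ hX hns ↦ hTL3 W hX hns) hres
  exact cornerAtThreeUpper_of_consumed_of_twist hGZ hKo hGZK hmod hTw (fun W _ _ hX hns ht ↦ hCons W hX hns ht)

/-! ## §2 The ITEMS-CLOSERS in the r16 (E′TD) and r17 (split auxiliary-norm) shapes -/

/-- **Crux 21420 BY NAME, r16 shape**: CR3 items `PublishedInputsThree` (19112), `ShimuraParametrizationDataNonempty` (19524), `ShimuraCasselsTateLevelInputs`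
(20191) + raw: STEP L, the twist halves, the two image-free Gross facts, the eight Kato-twin facts not in 19112, Pasten, Cai–Shu–Tian, the primitives at `3`
(inert ∕ guarded), the twin-lower supply, and **`hE0 : ShimuraWalk.PrimitivesWithE0PrimeTDAtThree`** (Gross's E′-label — STRICTLY WEAKER than r15's (B6) slot).
The corner's saved display D comes from `hE0` by `primitivesDivAtThreeInertD_of_primitivesWithE0PrimeTD` (p642540) ∘ lane B g9's D-entry. CONDITIONAL; the item
does NOT close by this file. [cite: GrossLMS1991, §6 p. 245] [cite: Jetchev2008, Thm. 1.4] [cite: Kato2004Asterisque, Thm. 12.4, §17.13] -/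
theorem cornerAtThreeW_of_itemsE0Prime
    (hP : Summit.BirchSwinnertonDyer.BirchSwinnertonDyer.Theses.ClassRecordThree.PublishedInputsThree)
    (hJL : Summit.BirchSwinnertonDyer.BirchSwinnertonDyer.Theses.ClassRecordThree.ShimuraParametrizationDataNonempty)
    (hCT : Summit.BirchSwinnertonDyer.BirchSwinnertonDyer.Theses.ClassRecordThree.ShimuraCasselsTateLevelInputs)
    (hS : Summit.BirchSwinnertonDyer.BirchSwinnertonDyer.Theorems.CornerAtThreeStepL)
    (hL : Summit.BirchSwinnertonDyer.BirchSwinnertonDyer.Theorems.CornerAtThreeTwistLower)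
    (hμ : Summit.BirchSwinnertonDyer.BirchSwinnertonDyer.Theorems.CornerAtThreeTwistMuAn)
    (hF2 :
      Literature.NumberTheory.EllipticCurves.GrossLMS1991.prop37_2_frobeniusCongruence ∧
      Literature.NumberTheory.EllipticCurves.Gross1991_heegnerPoint_sub_ratTorsion_mem_E0_imageFree)
    (hKato8 :
      Literature.NumberTheory.EllipticCurves.SteinWuthrich2013.thm61_splitMultiplicative ∧
      (∀ (W : WeierstrassCurve ℚ) [W.IsElliptic] [W.IsGloballyMinimal] (p : ℕ) [Fact p.Prime],
        Literature.NumberTheory.EllipticCurves.greenberg_stevens W p) ∧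
      Literature.NumberTheory.EllipticCurves.Kato2004.thm12_4 ∧
      Literature.NumberTheory.EllipticCurves.Kato2004.exists_multDivisibilityInputs_nonsplit ∧
      Literature.NumberTheory.EllipticCurves.Kato2004.exists_multDivisibilityInputs_split ∧
      Literature.NumberTheory.EllipticCurves.Greenberg1999.thm15_isTorsion_multiplicative_rat ∧
      Literature.NumberTheory.EllipticCurves.Wuthrich2014.corollary18_padicLFunction_mem_iwasawaAlgebra_multiplicative ∧
      Literature.NumberTheory.EllipticCurves.Kato2004.exists_multDivisibilityInputs_fine)
    (hCO : PastenShimura2024_componentOrders)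
    (hGZc : shimuraCurve_heegnerPoint_grossZagier)
    (hPrim : Literature.NumberTheory.EllipticCurves.shimuraCurve_heegnerSystem_primitivesAtThreeInert)
    (hPrimG : Literature.NumberTheory.EllipticCurves.shimuraCurve_heegnerSystem_primitivesAtThreeGuarded)
    (hTL3 : Summit.BirchSwinnertonDyer.BirchSwinnertonDyer.Theorems.CornerAtThreeFHTwinLowerSupply)
    (hE0 : Summit.BirchSwinnertonDyer.BirchSwinnertonDyer.Theorems.ShimuraWalk.PrimitivesWithE0PrimeTDAtThree) :
    Summit.BirchSwinnertonDyer.BirchSwinnertonDyer.Theses.ClassRecordThree.CornerAtThreeW := by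
  obtain ⟨hGZ, hKo, -, -, -, hGZK, hmod, hnf, hHL, hMaz, -, hFH, -, -, hJn, -, -, hpar, -, -⟩ := id hP
  obtain ⟨hJs, hGS, h12, hns, hsp, h15, h18, hfine⟩ := hKato8
  have hF := CornerFactsDischarged.katoTwinFactsThreeAn_of_twelve hJs hJn hGZK hmod hpar hGS h12 hns hsp h15 h18 hfine
  have hIs : CornerAtThreeShimuraInertSavedDisplayD :=
    ShimuraKolyvaginOfImage.cornerAtThreeShimuraInertSavedDisplayD_of_primitivesDivAtThreeInertD_of_casselsTateLevelInputs hCT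
      (ShimuraWalk.primitivesDivAtThreeInertD_of_primitivesWithE0PrimeTD hE0)
  have hU := cornerAtThreeUpper_of_inputs_of_savedDisplayD hF2 ⟨hCT, hPrim, hPrimG, hTL3⟩ hIs hL hμ
    ⟨⟨hJs, hJn, hGZK, hmod, hpar, hGS, h12, hns, hsp, h15, h18, hfine⟩, hKo, hnf, hGZ, hHL, hMaz, hFH, hJL, hCO, hGZc⟩
  have h : Summit.BirchSwinnertonDyer.BirchSwinnertonDyer.Theses.ClassRecordThree.CornerAtThree :=
    Summit.BirchSwinnertonDyer.BirchSwinnertonDyer.Theorems.cornerAtThree_of_branchesAn hS hU hL hμ hF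
  intro W _ _
  exact ⟨(h W).1,
    Summit.BirchSwinnertonDyer.BirchSwinnertonDyer.Theorems.CornerTwistWitness.cornerTwistWitnessAt_of_cornerTwistAt hnf hHL W (h W).2.1,
    (h W).2.2⟩

/-- **The `KolyvaginRoadThree` twin, r16 shape.** -/
theorem kolyvaginRoadThree_cornerAtThreeW_of_itemsE0Prime
    (hP : Summit.BirchSwinnertonDyer.BirchSwinnertonDyer.Theses.ClassRecordThree.PublishedInputsThree)
    (hJL : Summit.BirchSwinnertonDyer.BirchSwinnertonDyer.Theses.ClassRecordThree.ShimuraParametrizationDataNonempty)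
    (hCT : Summit.BirchSwinnertonDyer.BirchSwinnertonDyer.Theses.ClassRecordThree.ShimuraCasselsTateLevelInputs)
    (hS : Summit.BirchSwinnertonDyer.BirchSwinnertonDyer.Theorems.CornerAtThreeStepL)
    (hL : Summit.BirchSwinnertonDyer.BirchSwinnertonDyer.Theorems.CornerAtThreeTwistLower)
    (hμ : Summit.BirchSwinnertonDyer.BirchSwinnertonDyer.Theorems.CornerAtThreeTwistMuAn)
    (hF2 :
      Literature.NumberTheory.EllipticCurves.GrossLMS1991.prop37_2_frobeniusCongruence ∧
      Literature.NumberTheory.EllipticCurves.Gross1991_heegnerPoint_sub_ratTorsion_mem_E0_imageFree)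
    (hKato8 :
      Literature.NumberTheory.EllipticCurves.SteinWuthrich2013.thm61_splitMultiplicative ∧
      (∀ (W : WeierstrassCurve ℚ) [W.IsElliptic] [W.IsGloballyMinimal] (p : ℕ) [Fact p.Prime],
        Literature.NumberTheory.EllipticCurves.greenberg_stevens W p) ∧
      Literature.NumberTheory.EllipticCurves.Kato2004.thm12_4 ∧
      Literature.NumberTheory.EllipticCurves.Kato2004.exists_multDivisibilityInputs_nonsplit ∧
      Literature.NumberTheory.EllipticCurves.Kato2004.exists_multDivisibilityInputs_split ∧
      Literature.NumberTheory.EllipticCurves.Greenberg1999.thm15_isTorsion_multiplicative_rat ∧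
      Literature.NumberTheory.EllipticCurves.Wuthrich2014.corollary18_padicLFunction_mem_iwasawaAlgebra_multiplicative ∧
      Literature.NumberTheory.EllipticCurves.Kato2004.exists_multDivisibilityInputs_fine)
    (hCO : PastenShimura2024_componentOrders)
    (hGZc : shimuraCurve_heegnerPoint_grossZagier)
    (hPrim : Literature.NumberTheory.EllipticCurves.shimuraCurve_heegnerSystem_primitivesAtThreeInert)
    (hPrimG : Literature.NumberTheory.EllipticCurves.shimuraCurve_heegnerSystem_primitivesAtThreeGuarded)
    (hTL3 : Summit.BirchSwinnertonDyer.BirchSwinnertonDyer.Theorems.CornerAtThreeFHTwinLowerSupply)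
    (hE0 : Summit.BirchSwinnertonDyer.BirchSwinnertonDyer.Theorems.ShimuraWalk.PrimitivesWithE0PrimeTDAtThree) :
    Summit.BirchSwinnertonDyer.BirchSwinnertonDyer.Theses.KolyvaginRoadThree.CornerAtThreeW :=
  cornerAtThreeW_of_itemsE0Prime hP hJL hCT hS hL hμ hF2 hKato8 hCO hGZc hPrim hPrimG hTL3 hE0

/-- **Crux 21420 BY NAME, r17 shape**: as the r16 closer with the last binder replaced by **`hres : (a) ∧ (b) ∧ (c)`** — (a)
`ShimuraWalk.PrimitivesWithSplitNormTDAtThree` (print-level by statement), (b) tam3-p1 g18's `stub_carrierLocalE0AtThree` text ((T) ∧ (C), print, local;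
shared with 19109 r17), (c) `ShimuraWalk.AuxiliarySplitLevel W K ι 3 q N` on the corner frames (Chebotarev-grade) — NO identity-component ∕ E′ label; the corner's
saved display D by `ShimuraWalk.cornerAtThreeShimuraInertSavedDisplayD_of_residualStubsR17_of_casselsTate` (p644690). CONDITIONAL; the item does NOT close by this
file. [cite: Darmon2004, Prop. 3.10, Def. 3.12, Thm. 4.18] [cite: SilvermanATAEC1994, IV Cor. 9.2 (d), C.15] [cite: GrossLMS1991, §6 p. 245] -/
theorem cornerAtThreeW_of_itemsR17
    (hP : Summit.BirchSwinnertonDyer.BirchSwinnertonDyer.Theses.ClassRecordThree.PublishedInputsThree)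
    (hJL : Summit.BirchSwinnertonDyer.BirchSwinnertonDyer.Theses.ClassRecordThree.ShimuraParametrizationDataNonempty)
    (hCT : Summit.BirchSwinnertonDyer.BirchSwinnertonDyer.Theses.ClassRecordThree.ShimuraCasselsTateLevelInputs)
    (hS : Summit.BirchSwinnertonDyer.BirchSwinnertonDyer.Theorems.CornerAtThreeStepL)
    (hL : Summit.BirchSwinnertonDyer.BirchSwinnertonDyer.Theorems.CornerAtThreeTwistLower)
    (hμ : Summit.BirchSwinnertonDyer.BirchSwinnertonDyer.Theorems.CornerAtThreeTwistMuAn)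
    (hF2 :
      Literature.NumberTheory.EllipticCurves.GrossLMS1991.prop37_2_frobeniusCongruence ∧
      Literature.NumberTheory.EllipticCurves.Gross1991_heegnerPoint_sub_ratTorsion_mem_E0_imageFree)
    (hKato8 :
      Literature.NumberTheory.EllipticCurves.SteinWuthrich2013.thm61_splitMultiplicative ∧
      (∀ (W : WeierstrassCurve ℚ) [W.IsElliptic] [W.IsGloballyMinimal] (p : ℕ) [Fact p.Prime],
        Literature.NumberTheory.EllipticCurves.greenberg_stevens W p) ∧
      Literature.NumberTheory.EllipticCurves.Kato2004.thm12_4 ∧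
      Literature.NumberTheory.EllipticCurves.Kato2004.exists_multDivisibilityInputs_nonsplit ∧
      Literature.NumberTheory.EllipticCurves.Kato2004.exists_multDivisibilityInputs_split ∧
      Literature.NumberTheory.EllipticCurves.Greenberg1999.thm15_isTorsion_multiplicative_rat ∧
      Literature.NumberTheory.EllipticCurves.Wuthrich2014.corollary18_padicLFunction_mem_iwasawaAlgebra_multiplicative ∧
      Literature.NumberTheory.EllipticCurves.Kato2004.exists_multDivisibilityInputs_fine)
    (hCO : PastenShimura2024_componentOrders)
    (hGZc : shimuraCurve_heegnerPoint_grossZagier)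
    (hPrim : Literature.NumberTheory.EllipticCurves.shimuraCurve_heegnerSystem_primitivesAtThreeInert)
    (hPrimG : Literature.NumberTheory.EllipticCurves.shimuraCurve_heegnerSystem_primitivesAtThreeGuarded)
    (hTL3 : Summit.BirchSwinnertonDyer.BirchSwinnertonDyer.Theorems.CornerAtThreeFHTwinLowerSupply)
    (hres :
      Summit.BirchSwinnertonDyer.BirchSwinnertonDyer.Theorems.ShimuraWalk.PrimitivesWithSplitNormTDAtThree ∧
      (∀ (W : WeierstrassCurve ℚ) [W.IsElliptic] [W.IsGloballyMinimal] (K : Type) [Field K] [NumberField K] (ι : K →+* ℂ)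
        [∀ j : ℕ, NumberField (ringClassField K ι j)],
        IsImaginaryQuadratic K → ∀ (q : ℕ) [Fact q.Prime], 3 ∣ (W.baseChange ℚ_[q]).localTamagawaNumber ℤ_[q] →
        ((Ideal.span {(q : ℤ)}).primesOver (𝓞 K)).ncard = 2 →
        (∀ n : ℕ, n ≠ 0 → ¬ q ∣ n → ∀ (w : HeightOneSpectrum (𝓞 (ringClassField K ι n))),
          ((q : ℕ) : 𝓞 (ringClassField K ι n)) ∈ w.asIdeal →
          ∀ τ : ringClassField K ι n ≃ₐ[ℚ] ringClassField K ι n, τ • w.asIdeal = w.asIdeal →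
          ∀ P : (W.baseChange (ringClassField K ι n)).toAffine.Point,
            (placeIntModel W (ringClassField K ι n) w).HasNonsingularReduction (K := ringClassField K ι n)
              (pointGalHom W (ringClassField K ι n) τ P - P)) ∧
        (∀ n : ℕ, n ≠ 0 → ¬ q ∣ n → ∀ (w : HeightOneSpectrum (𝓞 (ringClassField K ι n))),
          ((q : ℕ) : 𝓞 (ringClassField K ι n)) ∈ w.asIdeal →
          ∀ P : (W.baseChange (ringClassField K ι n)).toAffine.Point,
            (placeIntModel W (ringClassField K ι n) w).HasNonsingularReduction (K := ringClassField K ι n)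
              ((W.baseChange ℚ_[q]).localTamagawaNumber ℤ_[q] • P))) ∧
      (∀ (W : WeierstrassCurve ℚ) [W.IsElliptic] [W.IsGloballyMinimal] (K : Type) [Field K] [NumberField K] (ι : K →+* ℂ)
        [∀ j : ℕ, NumberField (ringClassField K ι j)],
        IsImaginaryQuadratic K → NumberField.discr K < -4 →
        ((Ideal.span {(3 : ℤ)}).primesOver (𝓞 K)).ncard = 1 → ¬ (3 : ℤ) ∣ NumberField.discr K →
        ClassX11b W 3 → ¬ Surj W 3 →
        ∀ (q N : ℕ) [Fact q.Prime], ((Ideal.span {(q : ℤ)}).primesOver (𝓞 K)).ncard = 2 → N ≠ 0 →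
        3 ∣ (W.baseChange ℚ_[q]).localTamagawaNumber ℤ_[q] →
        Summit.BirchSwinnertonDyer.BirchSwinnertonDyer.Theorems.ShimuraWalk.AuxiliarySplitLevel W K ι 3 q N)) :
    Summit.BirchSwinnertonDyer.BirchSwinnertonDyer.Theses.ClassRecordThree.CornerAtThreeW := by
  obtain ⟨hGZ, hKo, -, -, -, hGZK, hmod, hnf, hHL, hMaz, -, hFH, -, -, hJn, -, -, hpar, -, -⟩ := id hP
  obtain ⟨hJs, hGS, h12, hns, hsp, h15, h18, hfine⟩ := hKato8
  have hF := CornerFactsDischarged.katoTwinFactsThreeAn_of_twelve hJs hJn hGZK hmod hpar hGS h12 hns hsp h15 h18 hfine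
  have hIs : CornerAtThreeShimuraInertSavedDisplayD :=
    ShimuraWalk.cornerAtThreeShimuraInertSavedDisplayD_of_residualStubsR17_of_casselsTate hCT hres
  have hU := cornerAtThreeUpper_of_inputs_of_savedDisplayD hF2 ⟨hCT, hPrim, hPrimG, hTL3⟩ hIs hL hμ
    ⟨⟨hJs, hJn, hGZK, hmod, hpar, hGS, h12, hns, hsp, h15, h18, hfine⟩, hKo, hnf, hGZ, hHL, hMaz, hFH, hJL, hCO, hGZc⟩
  have h : Summit.BirchSwinnertonDyer.BirchSwinnertonDyer.Theses.ClassRecordThree.CornerAtThree :=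
    Summit.BirchSwinnertonDyer.BirchSwinnertonDyer.Theorems.cornerAtThree_of_branchesAn hS hU hL hμ hF
  intro W _ _
  exact ⟨(h W).1,
    Summit.BirchSwinnertonDyer.BirchSwinnertonDyer.Theorems.CornerTwistWitness.cornerTwistWitnessAt_of_cornerTwistAt hnf hHL W (h W).2.1,
    (h W).2.2⟩

/-! ## §3 The ITEMS-CLOSER in the r19 shape: residual = (a) print-level primitives ∧ (c′) ONE Chebotarev–Kummer supply -/

/-- **Crux 21420 BY NAME, r19 shape**: as the r17 closer with the last binder replaced by **`hres : (a) ∧ (c′)`** — (a)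
`ShimuraWalk.PrimitivesWithSplitNormTDAtThree` (print-level by statement: Darmon 2004 Prop. 3.10 ∕ Def. 3.12 ∕ Thm. 4.18), (c′) ONE split prime-conductor
Chebotarev–Kummer supply on the corner frames (TRUE on every corner image, lane B g14 memo CORNER3-G14 §6; formalizable over the tree's proved Chebotarev). The (b)
conjunct of r17 ∕ r18 is DISCHARGED by tam3-p1 g18's `CarrierLocalE0.stub_carrierLocalE0AtThree`, the class-field-theoretic half of r17's (c) by lane B g14's
`…RingClassGalSplitCyclic` + `…ShimuraSplitAuxLevelOfSupply`; the corner's saved display D by `ShimuraWalk.cornerAtThreeShimuraInertSavedDisplayD_of_residualStubsR19_of_casselsTate`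
(p650985). So the audit `proof.conditional` list of THIS theorem is 21420's phase-2 itemization in the r19 shape: the CR3 items BY NAME, (L), the twist pair, the
named facts, (a) and (c′). CONDITIONAL; the item does NOT close by this file; BSD is proved for no curve.
[cite: Darmon2004, Prop. 3.10, Def. 3.12, Thm. 4.18] [cite: Cox2013, Thm. 8.12] [cite: GrossLMS1991, §6 p. 245] -/
theorem cornerAtThreeW_of_itemsR19
    (hP : Summit.BirchSwinnertonDyer.BirchSwinnertonDyer.Theses.ClassRecordThree.PublishedInputsThree)
    (hJL : Summit.BirchSwinnertonDyer.BirchSwinnertonDyer.Theses.ClassRecordThree.ShimuraParametrizationDataNonempty)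
    (hCT : Summit.BirchSwinnertonDyer.BirchSwinnertonDyer.Theses.ClassRecordThree.ShimuraCasselsTateLevelInputs)
    (hS : Summit.BirchSwinnertonDyer.BirchSwinnertonDyer.Theorems.CornerAtThreeStepL)
    (hL : Summit.BirchSwinnertonDyer.BirchSwinnertonDyer.Theorems.CornerAtThreeTwistLower)
    (hμ : Summit.BirchSwinnertonDyer.BirchSwinnertonDyer.Theorems.CornerAtThreeTwistMuAn)
    (hF2 :
      Literature.NumberTheory.EllipticCurves.GrossLMS1991.prop37_2_frobeniusCongruence ∧
      Literature.NumberTheory.EllipticCurves.Gross1991_heegnerPoint_sub_ratTorsion_mem_E0_imageFree)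
    (hKato8 :
      Literature.NumberTheory.EllipticCurves.SteinWuthrich2013.thm61_splitMultiplicative ∧
      (∀ (W : WeierstrassCurve ℚ) [W.IsElliptic] [W.IsGloballyMinimal] (p : ℕ) [Fact p.Prime],
        Literature.NumberTheory.EllipticCurves.greenberg_stevens W p) ∧
      Literature.NumberTheory.EllipticCurves.Kato2004.thm12_4 ∧
      Literature.NumberTheory.EllipticCurves.Kato2004.exists_multDivisibilityInputs_nonsplit ∧
      Literature.NumberTheory.EllipticCurves.Kato2004.exists_multDivisibilityInputs_split ∧
      Literature.NumberTheory.EllipticCurves.Greenberg1999.thm15_isTorsion_multiplicative_rat ∧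
      Literature.NumberTheory.EllipticCurves.Wuthrich2014.corollary18_padicLFunction_mem_iwasawaAlgebra_multiplicative ∧
      Literature.NumberTheory.EllipticCurves.Kato2004.exists_multDivisibilityInputs_fine)
    (hCO : PastenShimura2024_componentOrders)
    (hGZc : shimuraCurve_heegnerPoint_grossZagier)
    (hPrim : Literature.NumberTheory.EllipticCurves.shimuraCurve_heegnerSystem_primitivesAtThreeInert)
    (hPrimG : Literature.NumberTheory.EllipticCurves.shimuraCurve_heegnerSystem_primitivesAtThreeGuarded)
    (hTL3 : Summit.BirchSwinnertonDyer.BirchSwinnertonDyer.Theorems.CornerAtThreeFHTwinLowerSupply)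
    (hres :
      Summit.BirchSwinnertonDyer.BirchSwinnertonDyer.Theorems.ShimuraWalk.PrimitivesWithSplitNormTDAtThree ∧
      (∀ (W : WeierstrassCurve ℚ) [W.IsElliptic] [W.IsGloballyMinimal] (K : Type) [Field K] [NumberField K] (ι : K →+* ℂ)
        [∀ j : ℕ, NumberField (ringClassField K ι j)],
        IsImaginaryQuadratic K → NumberField.discr K < -4 →
        ((Ideal.span {(3 : ℤ)}).primesOver (𝓞 K)).ncard = 1 → ¬ (3 : ℤ) ∣ NumberField.discr K →
        ClassX11b W 3 → ¬ Surj W 3 →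
        ∀ (q N : ℕ) [Fact q.Prime], ((Ideal.span {(q : ℤ)}).primesOver (𝓞 K)).ncard = 2 → N ≠ 0 → q ∣ N →
        3 ∣ (W.baseChange ℚ_[q]).localTamagawaNumber ℤ_[q] →
        ∀ E m₀ : ℕ, Squarefree m₀ → (∀ r ∈ m₀.primeFactors, ¬ r ∣ N ∧ (Ideal.span {(r : 𝓞 K)}).IsPrime) →
          ∃ ℓ₀ : ℕ, ℓ₀.Prime ∧ ℓ₀ ≠ 2 ∧ ¬ ℓ₀ ∣ N ∧ ¬ ℓ₀ ∣ m₀ ∧ ((Ideal.span {(ℓ₀ : ℤ)}).primesOver (𝓞 K)).ncard = 2 ∧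
            (∀ v : HeightOneSpectrum (𝓞 K), ((ℓ₀ : ℕ) : 𝓞 K) ∈ v.asIdeal →
              Literature.NumberTheory.NumberFields.RingClassField.primeClass m₀ v = 1) ∧
            ¬ (3 : ℤ) ∣ W.frobeniusTrace ℓ₀ - 2 ∧
            ∀ v : HeightOneSpectrum (𝓞 K), ((q : ℕ) : 𝓞 K) ∈ v.asIdeal →
              3 ^ E ∣ orderOf (Literature.NumberTheory.NumberFields.RingClassField.primeClass ℓ₀ v))) :
    Summit.BirchSwinnertonDyer.BirchSwinnertonDyer.Theses.ClassRecordThree.CornerAtThreeW := by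
  obtain ⟨hGZ, hKo, -, -, -, hGZK, hmod, hnf, hHL, hMaz, -, hFH, -, -, hJn, -, -, hpar, -, -⟩ := id hP
  obtain ⟨hJs, hGS, h12, hns, hsp, h15, h18, hfine⟩ := hKato8
  have hF := CornerFactsDischarged.katoTwinFactsThreeAn_of_twelve hJs hJn hGZK hmod hpar hGS h12 hns hsp h15 h18 hfine
  have hIs : CornerAtThreeShimuraInertSavedDisplayD :=
    ShimuraWalk.cornerAtThreeShimuraInertSavedDisplayD_of_residualStubsR19_of_casselsTate hCT hres
  have hU := cornerAtThreeUpper_of_inputs_of_savedDisplayD hF2 ⟨hCT, hPrim, hPrimG, hTL3⟩ hIs hL hμ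
    ⟨⟨hJs, hJn, hGZK, hmod, hpar, hGS, h12, hns, hsp, h15, h18, hfine⟩, hKo, hnf, hGZ, hHL, hMaz, hFH, hJL, hCO, hGZc⟩
  have h : Summit.BirchSwinnertonDyer.BirchSwinnertonDyer.Theses.ClassRecordThree.CornerAtThree :=
    Summit.BirchSwinnertonDyer.BirchSwinnertonDyer.Theorems.cornerAtThree_of_branchesAn hS hU hL hμ hF
  intro W _ _
  exact ⟨(h W).1,
    Summit.BirchSwinnertonDyer.BirchSwinnertonDyer.Theorems.CornerTwistWitness.cornerTwistWitnessAt_of_cornerTwistAt hnf hHL W (h W).2.1,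
    (h W).2.2⟩

end Summit.BirchSwinnertonDyer.BirchSwinnertonDyer.Theorems.CornerAtThreeWOfInputs

end
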